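import Literature.NumberTheory.GaloisRepresentations.UnramifiedKummer
import Literature.NumberTheory.GaloisRepresentations.ModPGaloisRep
import HarnessLib

/-!
# Discharges of named facts of `ModPGaloisRep.lean`: independence of the uniformiser and surjectivity of the fundamental characters (trunk GalRep, item C15)

D-0014 keeps `Literature/` sorry-free by stating cited results as named facts `def X : Prop`.
This sibling file of `Literature.NumberTheory.GaloisRepresentations.ModPGaloisRep` (next to
`ModPGaloisRepProofs.lean`, which proves that the fundamental characters are *tame*) proves, as
`theorem X_holds : X`:

* `Literature.NumberTheory.GaloisRepresentations.kummerCharacter_eq_of_associated_holds` — on the inertia group the Kummer character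
  `σ ↦ σ(z)/z (mod 𝔓)` of `z ^ n = a` only depends on `a` up to a unit of `𝒪[F]`;
* `Literature.NumberTheory.GaloisRepresentations.fundamentalCharacter_eq_holds` — Serre's fundamental character of level `m` does not
  depend on the uniformiser `ϖ` (two uniformisers of the DVR `𝒪[F]` are associated);

and the *surjectivity* half of Serre's description of the tame inertia by the characters `θ_d`
(Invent. Math. 15 (1972), §1.3, "`θ_d : Gal(K_d/K_nr) → μ_d` … est un isomorphisme"; Prop. 1–2),
in the form consumed by Serre's recipe for the weight (item C16, `SerreWeightProofs`):

* `Literature.NumberTheory.GaloisRepresentations.exists_mem_absInertia_smul_kummerRoot` — for `d ≥ 1`, a uniformiser `ϖ`, the chosen root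
  `z = kummerRoot F hd ϖ` of `z ^ d = ϖ` and every `ζ` with `ζ ^ d = 1`, some `σ ∈ I_F` has
  `σ z = ζ z` (the case `z = kummerRoot` of
  `IsNonarchimedeanLocalField.exists_mem_absInertia_smul_eq_mul`, file `UnramifiedKummer`);
* `Literature.NumberTheory.GaloisRepresentations.exists_fundamentalCharacter_apply_eq` — the fundamental character `ψ_m : I_F → kˣ`
  (`m ≠ 0`) takes at some `τ ∈ I_F` the value `ι (ζ mod 𝔓)` for any prescribed
  `ζ ∈ μ_{q^m-1}(F̄)`; with the injectivity of reduction on `μ_{q^m-1}`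
  (`eq_one_of_pow_eq_one_of_sub_one_mem_absMaximalIdeal`) this says that `ψ_m` has exact order
  `q ^ m - 1` (Serre 1972, §1.7: `θ_{q-1} : I_t → μ_{q-1} = 𝔽_q^*` is surjective).

## Proofs

`kummerCharacter_eq_of_associated`: if `a' = a u` with `u ∈ 𝒪[F]ˣ` and `z ^ n = a`,
`z' ^ n = a'` are the chosen roots, then `w = z'/z` satisfies `w ^ n = u`, so `w` is a unit of
`S`, and for `σ ∈ I_F` one has `σ(w) ≡ w (mod 𝔓)` (definition of `I_F`), whence
`σ(z')/z' = (σ(w)/w)(σ(z)/z) ≡ σ(z)/z (mod 𝔓)`.  This is Serre's remark "`K_d` et `θ_d` ne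
dépendent pas du choix de `x`, ni de celui de sa racine `d`-ième" (1972, §1.3) and the
independence of the uniformiser in *Local Fields*, Ch. IV §2, Prop. 7.  The surjectivity is
`UnramifiedKummer.exists_mem_absInertia_smul_eq_mul` (the Kummer extension `F_nr(ϖ^{1/d})/F_nr`
has degree `d` and `Aut(F̄/F_nr) = I_F`), read through the cocycle `kummerCocycleInt`.

## References

* [SerreInventiones1972] J.-P. Serre, *Propriétés galoisiennes des points d'ordre fini des courbes
  elliptiques*, Invent. Math. 15 (1972), §1.3 (`K_d = K_nr(x^{1/d})`, `θ_d` an isomorphism,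
  independence of `x` and of the root; Prop. 1–2), §1.7 (fundamental characters of level `n`).
* [SerreLocalFields1979] J.-P. Serre, *Local Fields*, GTM 67, Ch. IV §2, Prop. 7 (independence of
  the uniformiser).
* [Serre1987] J.-P. Serre, Duke Math. J. 54 (1987), §2.1 (characters of `I_t` of level 1 and 2).
-/

noncomputable section

open scoped Valued
open Field ValuativeRel

namespace Literature.NumberTheory.GaloisRepresentations

open GaloisRepresentations.IsNonarchimedeanLocalField

universe u v

variable (F : Type u) [Field F] [ValuativeRel F]

variable {F} in
/-- If `σ ∈ Gal(F̄/F)` multiplies the chosen root `z ≠ 0` of `z ^ n = a` by `ζ`, then the Kummer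
cocycle `σ(z)/z` at `σ` is `ζ` (as an element of `F̄`).  Ref: Serre, Invent. Math. 15 (1972),
§1.3 (`s(x^{1/d}) = θ_d(s) x^{1/d}`). [folklore] -/
theorem coe_kummerCocycleInt_eq_of_smul_eq {n : ℕ} (hn : 0 < n) {a : 𝒪[F]} (ha : a ≠ 0)
    (σ : absoluteGaloisGroup F) {ζ : AlgebraicClosure F}
    (h : σ • (kummerRoot F hn a : AlgebraicClosure F) = ζ * kummerRoot F hn a) :
    (kummerCocycleInt F hn ha σ : AlgebraicClosure F) = ζ := by
  rw [coe_kummerCocycleInt, kummerCocycle, h, mul_div_assoc,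
    div_self (coe_kummerRoot_ne_zero hn ha), mul_one]

variable [TopologicalSpace F] [IsNonarchimedeanLocalField F]
variable {k : Type v} [Field k]

/-- **Discharge of `Literature.NumberTheory.GaloisRepresentations.kummerCharacter_eq_of_associated`** (item C15).  On the inertia group
the Kummer character of `a` only depends on `a` up to units: if `a' = a u` with `u ∈ 𝒪[F]ˣ` and
`z ^ n = a`, `z' ^ n = a'` are the chosen roots, then `w = z'/z` satisfies `w ^ n = u`, so `w` is
a unit of `S`, and for `σ ∈ I_F` one has `σ(w) ≡ w (mod 𝔓)`, whence
`σ(z')/z' = (σ(w)/w)(σ(z)/z) ≡ σ(z)/z (mod 𝔓)`.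
Ref: Serre, Invent. Math. 15 (1972), §1.3 ("`θ_d` ne dépend pas du choix de `x`, ni de celui de
sa racine `d`-ième"); Serre, *Local Fields*, Ch. IV §2, Prop. 7. [cite: SerreInventiones1972, §1.3] -/
theorem kummerCharacter_eq_of_associated_holds {n : ℕ} (hn : 0 < n) :
    kummerCharacter_eq_of_associated F hn (k := k) := by
  intro a a' ha ha' h ι
  obtain ⟨u, hu⟩ := h
  set z : AlgebraicClosure F := (kummerRoot F hn a : AlgebraicClosure F) with hz
  set z' : AlgebraicClosure F := (kummerRoot F hn a' : AlgebraicClosure F) with hz'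
  have hz0 : z ≠ 0 := coe_kummerRoot_ne_zero hn ha
  have hz'0 : z' ≠ 0 := coe_kummerRoot_ne_zero hn ha'
  -- `w = z'/z` satisfies `w ^ n = u`
  have hwn : (z' / z) ^ n = algebraMap 𝒪[F] (AlgebraicClosure F) (u : 𝒪[F]) := by
    have ha0 : algebraMap 𝒪[F] (AlgebraicClosure F) a ≠ 0 := by
      rw [← coe_kummerRoot_pow F hn a]; exact pow_ne_zero _ hz0
    rw [div_pow, hz, hz', coe_kummerRoot_pow, coe_kummerRoot_pow, ← hu, map_mul,
      mul_div_cancel_left₀ _ ha0]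
  have hwint : IsIntegral 𝒪[F] (z' / z) :=
    IsIntegral.of_pow hn (by rw [hwn]; exact isIntegral_algebraMap)
  set W : absIntegers 𝒪[F] F := ⟨z' / z, hwint⟩ with hW
  have hWn : W ^ n = algebraMap 𝒪[F] (absIntegers 𝒪[F] F) (u : 𝒪[F]) := Subtype.ext hwn
  have hWu : IsUnit W := by
    rw [← isUnit_pow_iff hn.ne', hWn]
    exact (Units.isUnit u).map _
  obtain ⟨Wu, hWu'⟩ := hWu
  have hWinv : ((Wu⁻¹ : (absIntegers 𝒪[F] F)ˣ) : AlgebraicClosure F) = (z' / z)⁻¹ := by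
    have h1 : ((Wu⁻¹ : (absIntegers 𝒪[F] F)ˣ) : AlgebraicClosure F) * (z' / z) = 1 := by
      have := congrArg (fun x : absIntegers 𝒪[F] F => (x : AlgebraicClosure F)) (Wu.inv_mul)
      simpa [hWu'] using this
    exact eq_inv_of_mul_eq_one_left h1
  ext σ
  rw [coe_kummerCharacter_apply, coe_kummerCharacter_apply]
  congr 1
  rw [Ideal.Quotient.eq]
  have hσW : (σ : absoluteGaloisGroup F) • W - W ∈ absMaximalIdeal F := σ.2 W
  have key : kummerCocycleInt F hn ha σ - kummerCocycleInt F hn ha' σ =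
      -(((σ : absoluteGaloisGroup F) • W - W) * (Wu⁻¹ : (absIntegers 𝒪[F] F)ˣ) *
        kummerCocycleInt F hn ha σ) := by
    refine Subtype.ext ?_
    have hσz0 : (σ : absoluteGaloisGroup F) • z ≠ 0 := by
      rw [absoluteGaloisGroup.smul_def]; exact (map_ne_zero _).mpr hz0
    simp only [AddSubgroupClass.coe_sub, NegMemClass.coe_neg, Subalgebra.coe_mul,
      integralClosure.coe_smul, coe_kummerCocycleInt, kummerCocycle, hWinv, hW]
    rw [← hz, ← hz']
    simp only [absoluteGaloisGroup.smul_def, map_div₀] at hσz0 ⊢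
    field_simp
    ring
  rw [key]
  exact neg_mem (Ideal.mul_mem_right _ _ (Ideal.mul_mem_right _ _ hσW))

/-- **Discharge of `Literature.NumberTheory.GaloisRepresentations.fundamentalCharacter_eq`** (item C15): the fundamental character of level
`m` does not depend on the uniformiser (two uniformisers of the discrete valuation ring `𝒪[F]` are
associated, Mathlib `IsDiscreteValuationRing.associated_of_irreducible`, and
`kummerCharacter_eq_of_associated_holds`).
Ref: Serre, Invent. Math. 15 (1972), §1.3 ("`K_d` et `θ_d` ne dépendent pas du choix de `x`, ni
de celui de sa racine `d`-ième"). [cite: SerreInventiones1972, §1.3] -/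
theorem fundamentalCharacter_eq_holds : fundamentalCharacter_eq F (k := k) := by
  intro m ι ϖ ϖ' hϖ hϖ'
  by_cases hm : m = 0
  · subst hm
    rw [fundamentalCharacter, fundamentalCharacter, dif_pos rfl, dif_pos rfl]
  · rw [fundamentalCharacter_of_ne_zero F hm, fundamentalCharacter_of_ne_zero F hm]
    exact kummerCharacter_eq_of_associated_holds F _ hϖ.ne_zero hϖ'.ne_zero
      (IsDiscreteValuationRing.associated_of_irreducible _ hϖ hϖ') ι

/-- **The Kummer character `θ_d : I_F → μ_d` of a uniformiser is surjective**: for `d ≥ 1`, a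
uniformiser `ϖ`, the chosen root `z = kummerRoot F hd ϖ` of `z ^ d = ϖ` (item C15) and every
`ζ ∈ F̄` with `ζ ^ d = 1`, some `σ` in the inertia group `I_F = absInertia F` satisfies
`σ(z) = ζ z` (`UnramifiedKummer.exists_mem_absInertia_smul_eq_mul`).  Serre: "si
`s ∈ Gal(K_d/K_nr)`, il existe une unique racine `d`-ième de l'unité `θ_d(s)` telle que
`s(x^{1/d}) = θ_d(s) x^{1/d}`, et l'application `θ_d : Gal(K_d/K_nr) → μ_d` ainsi définie est un
isomorphisme" (and `I = Gal(K_s/K_nr)` maps onto `Gal(K_d/K_nr)`; Prop. 1: `θ : I_t ≃ lim← μ_d`).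
[cite: SerreInventiones1972, §1.3 (θ_d isomorphisme) and Prop. 1] -/
theorem exists_mem_absInertia_smul_kummerRoot {d : ℕ} (hd : 0 < d) {ϖ : 𝒪[F]} (hϖ : Irreducible ϖ)
    (ζ : AlgebraicClosure F) (hζ : ζ ^ d = 1) :
    ∃ σ ∈ absInertia F,
      σ • (kummerRoot F hd ϖ : AlgebraicClosure F) = ζ * kummerRoot F hd ϖ :=
  exists_mem_absInertia_smul_eq_mul hd hϖ (coe_kummerRoot_pow F hd ϖ) hζ

/-- **The level-`m` fundamental character takes every prescribed value**: for `m ≠ 0` and every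
`ζ ∈ F̄` with `ζ ^ (q ^ m - 1) = 1` there are `τ ∈ I_F` and `Z ∈ S` with `Z = ζ` and
`ψ_m(τ) = ι (Z mod 𝔓)` (`ψ_m = fundamentalCharacter F m ι ϖ hϖ`).  With the injectivity of
reduction on `μ_{q^m-1}` this is the surjectivity of `θ_{q^m-1} : I_t → μ_{q^m-1} ≅ 𝔽_{q^m}^*`.
Ref: Serre, Invent. Math. 15 (1972), §1.3, Prop. 1–2; §1.7 (fundamental characters of level `n`:
`θ_{q-1}` composed with `𝔽_q → k`). [cite: SerreInventiones1972, §1.3 Prop. 2 and §1.7] -/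
theorem exists_fundamentalCharacter_apply_eq {m : ℕ} (hm : m ≠ 0)
    (ι : absIntegers 𝒪[F] F ⧸ absMaximalIdeal F →+* k) (ϖ : 𝒪[F])
    (hϖ : Irreducible ϖ) (ζ : AlgebraicClosure F) (hζ : ζ ^ (residueFieldCard F ^ m - 1) = 1) :
    ∃ (τ : absInertia F) (Z : absIntegers 𝒪[F] F), (Z : AlgebraicClosure F) = ζ ∧
      (fundamentalCharacter F m ι ϖ hϖ τ : k) = ι (Ideal.Quotient.mk _ Z) := by
  obtain ⟨σ, hσI, hσz⟩ :=
    exists_mem_absInertia_smul_kummerRoot F (residueFieldCard_pow_sub_one_pos F hm) hϖ ζ hζ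
  refine ⟨⟨σ, hσI⟩, kummerCocycleInt F (residueFieldCard_pow_sub_one_pos F hm) hϖ.ne_zero σ,
    coe_kummerCocycleInt_eq_of_smul_eq _ hϖ.ne_zero σ hσz, ?_⟩
  rw [fundamentalCharacter_of_ne_zero F hm, coe_kummerCharacter_apply]

end Literature.NumberTheory.GaloisRepresentations

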